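import Mathlib.RepresentationTheory.Homological.GroupCohomology.Functoriality
import Literature.AlgebraicGeometry.HodgeTheory.LocallyTrivialExtensionClasses

/-!
# Route LinearSystemTorelli — crux `LocalTubeSpan` (stmt-HodgeConjecture-2490): the algebraic spine

Helper file (`--supports stmt-HodgeConjecture-2490`, line `Sketch` of the crux chain). The crux
("local Schnell theorem": at every point `s₀` of the discriminant, Schnell's third map
`H¹(G_{s₀}, V) → ∏_{g ∈ G_{s₀}} V/(g - 1)V` loses nothing on the classes coming from primitive
cohomology) is still INFORMAL in the route file; what every proposed line (crux idea cards
`central-meridian-inflation`, `pencil-configuration-janssen`, `johnson-flux-detection`,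
`suspended-lattice-radical-steering`) composes with its geometric input is the following
group-cohomological layer over the tree's vocabulary
(`Literature.AlgebraicGeometry.HodgeTheory.LocallyTrivialExtensionClasses`: `H1resKer`, `evalCoinv`,
`evalCoinvOn`, `subOneRange`), proved here in full:

* `localTubeSpan_H1resKer_closure_mk_iff`, `localTubeSpan_H1resKer_zpowers_eq_ker_eval`,
  `localTubeSpan_ker_evalCoinv_eq_iInf_H1resKer_zpowers` — restriction kernels of (cyclic)
  subgroups: a class is undetected by `T` iff it restricts to zero on `⟨T⟩` (converse of the
  tree's `H1resKer_le_ker_evalCoinvOn` for cyclic subgroups; [Schnell2010] §3, the third map).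
* `localTubeSpan_H1resKer_eq_range_inf` — inflation–restriction: `ker res_S = im inf` for normal
  `S` (Mathlib `groupCohomology.H1InfRes_exact`); with `S = ⟨T⟩` central this is the lever of
  card `central-meridian-inflation`.
* `localTubeSpan_mem_H1resKer_of_evalCoinv_eq_zero`,
  `localTubeSpan_ker_evalCoinv_le_H1resKer_ker_rho` — undetected classes vanish on every subgroup
  acting trivially ([Schnell2010] §7, first paragraph of the proof of Prop. 12).
* `localTubeSpan_injective_evalCoinv_res_iff_of_surjective` — RELATION ERASURE: along a
  surjection `f : G ↠ H`, injectivity of the third map for `f^*B` and for `B` are equivalent; so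
  the local statement depends only on the linear local monodromy group `Γ_loc = ρ(G_{s₀})`, not
  on a presentation of `G_{s₀}` (loc. cit.).
* `localTubeSpan_ker_evalCoinvOn_eq_H1resKer_of_injective` — the local form: injectivity of the
  third map of `A|_S` gives `ker (evalCoinvOn A S) = H1resKer A S` (the c-free local Schnell
  property at `S`).
* `localTubeSpan_subOneRange_inv`, `localTubeSpan_subOneRange_le_of_closure_eq_top`,
  `localTubeSpan_cocycles₁_apply_mem_of_closure_eq_top`,
  `localTubeSpan_cocycles₁_apply_mem_span_of_undetected` — for a group generated by rank-one
  elements (`(t - 1)V ⊆ k·δ_t`, transvections) an undetected cocycle takes all its values in the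
  local vanishing lattice `span{δ_t}` (entry point of the orbit-wise analysis of card
  `pencil-configuration-janssen`; [Schnell2010] §7).

All statements are over an arbitrary commutative ring `k` and group `G`; no named facts, no
geometry. References: C. Schnell, *Primitive cohomology and the tube mapping*, Math. Z. 268
(2010) (= arXiv:0711.3927) §3 (three maps), §6 Example, §7 proof of Prop. 12.
-/

-- `Summit.HodgeConjecture.HodgeConjecture.Theorems` is the mandated namespace (single-conjunct summit:
-- Sub = Summit), which `linter.dupNamespace` flags on every declaration; the lakefile turns the
-- linter off tree-wide (weak option), restated here so stand-alone elaboration is warning-free too.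
set_option linter.dupNamespace false

noncomputable section

open CategoryTheory groupCohomology
open Literature.AlgebraicGeometry.HodgeTheory

namespace Summit.HodgeConjecture.HodgeConjecture.Theorems

universe u

variable {k G : Type u} [CommRing k] [Group G] (A : Rep k G)

/-- For a `1`-cocycle `φ` and a vector `x`, the set of `g` with `φ g = g·x - x` is a subgroup;
hence a class restricts to zero on the subgroup generated by `s` iff some single `x` works for
every generator in `s`. [folklore] -/
theorem localTubeSpan_H1resKer_closure_mk_iff (s : Set G) (φ : cocycles₁ A) :
    H1π A φ ∈ H1resKer A (Subgroup.closure s) ↔ ∃ x : A.V, ∀ g ∈ s, A.ρ g x - x = φ g := by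
  rw [H1resKer_mk_iff]
  constructor
  · rintro ⟨x, hx⟩
    exact ⟨x, fun g hg => hx g (Subgroup.subset_closure hg)⟩
  · rintro ⟨x, hx⟩
    refine ⟨x, fun g hg => ?_⟩
    induction hg using Subgroup.closure_induction with
    | mem g hg => exact hx g hg
    | one => simp
    | mul g h _ _ ihg ihh =>
        rw [(mem_cocycles₁_iff φ).1 φ.2 g h, ← ihg, ← ihh, map_mul, Module.End.mul_apply,
          map_sub]
        abel
    | inv g _ ih =>
        have h1 : (φ : G → A.V) g⁻¹ = -(A.ρ g⁻¹ ((φ : G → A.V) g)) := by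
          have := congrArg (A.ρ g⁻¹) (cocycles₁_map_inv φ g)
          rwa [Representation.inv_self_apply, map_neg] at this
        rw [h1, ← ih, map_sub, Representation.inv_self_apply]
        abel

/-- **Cyclic subgroups.** A class restricts to zero on `⟨T⟩` iff its value at `T` lies in
`(T - 1)A`, i.e. iff it is undetected by `T` under Schnell's third map:
`ker (res : H¹(G, A) → H¹(⟨T⟩, A)) = ker (pr_T ∘ evalCoinv)`.
[cite: Schnell2010, §3 (the third map)] -/
theorem localTubeSpan_H1resKer_zpowers_eq_ker_eval (T : G) :
    H1resKer A (Subgroup.zpowers T) = LinearMap.ker (LinearMap.proj T ∘ₗ evalCoinv A) := by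
  ext ξ
  induction ξ using H1_induction_on with
  | h φ =>
    rw [Subgroup.zpowers_eq_closure, localTubeSpan_H1resKer_closure_mk_iff, LinearMap.mem_ker,
      LinearMap.comp_apply, LinearMap.proj_apply, evalCoinv_H1π, Submodule.mkQ_apply,
      Submodule.Quotient.mk_eq_zero, LinearMap.mem_range]
    simp only [Set.mem_singleton_iff, forall_eq, LinearMap.sub_apply, LinearMap.id_apply]

/-- The kernel of Schnell's third map is the intersection of the restriction kernels of all
cyclic subgroups. [cite: Schnell2010, §3 (the third map, eq. (restr-M))] -/
theorem localTubeSpan_ker_evalCoinv_eq_iInf_H1resKer_zpowers :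
    LinearMap.ker (evalCoinv A) = ⨅ g : G, H1resKer A (Subgroup.zpowers g) := by
  ext ξ
  simp only [LinearMap.mem_ker, Submodule.mem_iInf, localTubeSpan_H1resKer_zpowers_eq_ker_eval,
    LinearMap.comp_apply, LinearMap.proj_apply]
  exact funext_iff

/-- **Inflation–restriction.** For a normal subgroup `S`, the restriction kernel of `S` is the
image of inflation `H¹(G ⧸ S, A^S) → H¹(G, A)` (Mathlib's `H1InfRes_exact`). [folklore] -/
theorem localTubeSpan_H1resKer_eq_range_inf (S : Subgroup G) [S.Normal] :
    H1resKer A S = LinearMap.range (groupCohomology.H1InfRes A S).f.hom := by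
  rw [(H1InfRes_exact A S).moduleCat_range_eq_ker]
  rfl

/-- A class undetected by Schnell's third map restricts to zero on every subgroup acting
trivially on `A` (there `(g - 1)A = 0`, so the cocycle itself vanishes).
[cite: Schnell2010, §7 (proof of Prop. 12, first paragraph)] -/
theorem localTubeSpan_mem_H1resKer_of_evalCoinv_eq_zero (K : Subgroup G)
    (hK : ∀ g ∈ K, ∀ v : A.V, A.ρ g v = v) {ξ : H1 A} (hξ : evalCoinv A ξ = 0) :
    ξ ∈ H1resKer A K := by
  induction ξ using H1_induction_on with
  | h φ =>
    refine (H1resKer_mk_iff K φ).2 ⟨0, fun g hg => ?_⟩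
    have h := congr_fun hξ g
    rw [evalCoinv_H1π, Pi.zero_apply, Submodule.mkQ_apply, Submodule.Quotient.mk_eq_zero] at h
    obtain ⟨v, hv⟩ := h
    rw [map_zero, sub_zero, ← hv, LinearMap.sub_apply, LinearMap.id_apply, hK g hg v, sub_self]

/-- Undetected classes vanish on the kernel of the representation.
[cite: Schnell2010, §7 (proof of Prop. 12, first paragraph)] -/
theorem localTubeSpan_ker_evalCoinv_le_H1resKer_ker_rho :
    LinearMap.ker (evalCoinv A) ≤ H1resKer A (MonoidHom.ker A.ρ) := fun _ hξ =>
  localTubeSpan_mem_H1resKer_of_evalCoinv_eq_zero A _ (fun g hg v => by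
    rw [MonoidHom.mem_ker] at hg
    rw [hg]; rfl) hξ

/-- **Local form.** If Schnell's third map of `A|_S` is injective then the classes of `H¹(G, A)`
undetected by the elements of `S` are exactly those restricting to zero on `S`. [folklore] -/
theorem localTubeSpan_ker_evalCoinvOn_eq_H1resKer_of_injective (S : Subgroup G)
    (h : Function.Injective (evalCoinv (Rep.res S.subtype A))) :
    LinearMap.ker (evalCoinvOn A S) = H1resKer A S := by
  ext ξ
  change evalCoinv (Rep.res S.subtype A) ((H1res A S).hom ξ) = 0 ↔ (H1res A S).hom ξ = 0
  exact ⟨fun h0 => h (h0.trans (map_zero _).symm), fun h0 => by rw [h0, map_zero]⟩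


/-! ### Relation erasure: injectivity of the third map depends only on the image group -/

section Erasure

variable {H : Type u} [Group H] (f : G →* H) (B : Rep k H)

/-- A `1`-cocycle of `G` with values in a representation pulled back along `f : G →* H` that
vanishes on `ker f` is constant on the fibres of `f`. [folklore] -/
theorem localTubeSpan_cocycles₁_res_apply_eq_of_map_eq (φ : cocycles₁ (Rep.res f B))
    (h0 : ∀ m : G, f m = 1 → (φ : G → B.V) m = 0) {g₁ g₂ : G} (hg : f g₁ = f g₂) :
    (φ : G → B.V) g₁ = (φ : G → B.V) g₂ := by
  have hm : f (g₁⁻¹ * g₂) = 1 := by rw [map_mul, map_inv, hg, inv_mul_cancel]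
  have := (mem_cocycles₁_iff φ).1 φ.2 g₁ (g₁⁻¹ * g₂)
  rw [mul_inv_cancel_left, h0 _ hm, map_zero, zero_add] at this
  exact this.symm

/-- An undetected cocycle (all values `φ g ∈ (g - 1)B`) of a pulled-back representation vanishes
on `ker f`, where `(g - 1)B = 0`. [cite: Schnell2010, §7 (proof of Prop. 12, first paragraph)] -/
theorem localTubeSpan_cocycles₁_res_apply_eq_zero_of_undetected (φ : cocycles₁ (Rep.res f B))
    (hφ : ∀ g : G, (φ : G → B.V) g ∈ subOneRange (Rep.res f B) g) (m : G) (hm : f m = 1) :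
    (φ : G → B.V) m = 0 := by
  obtain ⟨v, hv⟩ := hφ m
  rw [← hv, LinearMap.sub_apply, LinearMap.id_apply, Rep.coe_res_obj_ρ', hm, map_one,
    Module.End.one_apply, sub_self]

/-- **Relation erasure** ([Schnell2010] §7, first paragraph of the proof of Prop. 12: "we may
replace `G` by its image"). For a surjection `f : G ↠ H` and an `H`-representation `B`, Schnell's
third map `H¹(G, f^*B) → ∏_g B/(g - 1)B` is injective iff `H¹(H, B) → ∏_h B/(h - 1)B` is: an
undetected cocycle of `G` vanishes on `ker f` (which acts trivially), hence descends to an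
undetected cocycle of `H`. In the route: injectivity of the local tube map depends only on the
linear local monodromy group `Γ_loc = ρ(G_{s₀}) ≤ GL(V)`, not on the presentation of `G_{s₀}`.
[cite: Schnell2010, §7 (proof of Prop. 12)] -/
theorem localTubeSpan_injective_evalCoinv_res_iff_of_surjective (hf : Function.Surjective f) :
    Function.Injective (evalCoinv (Rep.res f B)) ↔ Function.Injective (evalCoinv B) := by
  constructor
  · -- pull back an undetected cocycle of `H` to `G`
    intro hinj
    refine (injective_iff_map_eq_zero _).2 fun η hη => ?_
    induction η using H1_induction_on with
    | h ψ =>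
      -- the pulled-back cocycle
      have hφmem : (fun g : G => (ψ : H → B.V) (f g)) ∈ cocycles₁ (Rep.res f B) := by
        rw [mem_cocycles₁_iff]
        intro g₁ g₂
        simp only [map_mul]
        exact (mem_cocycles₁_iff ψ).1 ψ.2 (f g₁) (f g₂)
      set φ : cocycles₁ (Rep.res f B) := ⟨_, hφmem⟩ with hφdef
      have hφ0 : evalCoinv (Rep.res f B) (H1π _ φ) = 0 := by
        funext g
        have := congr_fun hη (f g)
        rw [evalCoinv_H1π, Pi.zero_apply, Submodule.mkQ_apply, Submodule.Quotient.mk_eq_zero]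
          at this ⊢
        obtain ⟨v, hv⟩ := this
        exact ⟨v, hv⟩
      have hzero : H1π _ φ = 0 := (injective_iff_map_eq_zero _).1 hinj _ hφ0
      rw [H1π_eq_zero_iff, mem_coboundaries₁_iff_exists] at hzero
      obtain ⟨y, hy⟩ := hzero
      rw [H1π_eq_zero_iff, mem_coboundaries₁_iff_exists]
      refine ⟨y, fun h => ?_⟩
      obtain ⟨g, rfl⟩ := hf h
      have := hy g
      rwa [Rep.coe_res_obj_ρ'] at this
  · -- descend an undetected cocycle of `G` to `H`
    intro hinj
    refine (injective_iff_map_eq_zero _).2 fun ξ hξ => ?_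
    induction ξ using H1_induction_on with
    | h φ =>
      have hφ : ∀ g : G, (φ : G → B.V) g ∈ subOneRange (Rep.res f B) g := fun g => by
        have := congr_fun hξ g
        rwa [evalCoinv_H1π, Pi.zero_apply, Submodule.mkQ_apply, Submodule.Quotient.mk_eq_zero]
          at this
      have h0 := localTubeSpan_cocycles₁_res_apply_eq_zero_of_undetected f B φ hφ
      -- the descended cochain
      let σ : H → G := Function.surjInv hf
      have hσ : ∀ h, f (σ h) = h := Function.surjInv_eq hf
      have hdesc : ∀ g : G, (φ : G → B.V) g = (φ : G → B.V) (σ (f g)) := fun g =>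
        localTubeSpan_cocycles₁_res_apply_eq_of_map_eq f B φ h0 (by rw [hσ])
      have hψmem : (fun h : H => (φ : G → B.V) (σ h)) ∈ cocycles₁ B := by
        rw [mem_cocycles₁_iff]
        intro h₁ h₂
        have e1 : (φ : G → B.V) (σ (h₁ * h₂)) = (φ : G → B.V) (σ h₁ * σ h₂) :=
          localTubeSpan_cocycles₁_res_apply_eq_of_map_eq f B φ h0 (by rw [map_mul, hσ, hσ, hσ])
        rw [e1, (mem_cocycles₁_iff φ).1 φ.2 (σ h₁) (σ h₂), Rep.coe_res_obj_ρ', hσ]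
      set ψ : cocycles₁ B := ⟨_, hψmem⟩ with hψdef
      have hψ0 : evalCoinv B (H1π B ψ) = 0 := by
        funext h
        rw [evalCoinv_H1π, Pi.zero_apply, Submodule.mkQ_apply, Submodule.Quotient.mk_eq_zero]
        obtain ⟨v, hv⟩ := hφ (σ h)
        refine ⟨v, ?_⟩
        have hv' : B.ρ (f (σ h)) v - v = (φ : G → B.V) (σ h) := hv
        rw [hσ] at hv'
        exact hv'
      have hzero : H1π B ψ = 0 := (injective_iff_map_eq_zero _).1 hinj _ hψ0
      rw [H1π_eq_zero_iff, mem_coboundaries₁_iff_exists] at hzero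
      obtain ⟨y, hy⟩ := hzero
      rw [H1π_eq_zero_iff, mem_coboundaries₁_iff_exists]
      refine ⟨y, fun g => ?_⟩
      rw [Rep.coe_res_obj_ρ', hy (f g)]
      exact (hdesc g).symm

end Erasure

/-! ### Values of undetected cocycles of a group generated by "rank-one" elements -/

/-- `(g⁻¹ - 1)A ⊆ (g - 1)A`: `(g⁻¹ - 1)v = (g - 1)(-g⁻¹v)`. [folklore] -/
theorem localTubeSpan_subOneRange_inv_le (g : G) : subOneRange A g⁻¹ ≤ subOneRange A g := by
  rintro _ ⟨v, rfl⟩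
  refine ⟨-(A.ρ g⁻¹ v), ?_⟩
  simp only [LinearMap.sub_apply, LinearMap.id_apply, map_neg, Representation.self_inv_apply]
  abel

/-- `(g⁻¹ - 1)A = (g - 1)A`. [folklore] -/
theorem localTubeSpan_subOneRange_inv (g : G) : subOneRange A g⁻¹ = subOneRange A g :=
  le_antisymm (localTubeSpan_subOneRange_inv_le A g)
    (by simpa using localTubeSpan_subOneRange_inv_le A g⁻¹)

/-- If a submodule `M` contains `(t - 1)A` for every `t` in a generating set `s` of `G`, then it
contains `(g - 1)A` for every `g ∈ G` (`gh - 1 = (g - 1)(h - 1) + (h - 1) + (g - 1)` and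
`(g⁻¹ - 1)A = (g - 1)A`); in particular `M` is `G`-stable. [folklore] -/
theorem localTubeSpan_subOneRange_le_of_closure_eq_top (s : Set G) (hs : Subgroup.closure s = ⊤)
    (M : Submodule k A.V) (hM : ∀ t ∈ s, subOneRange A t ≤ M) (g : G) : subOneRange A g ≤ M := by
  have hg : g ∈ Subgroup.closure s := by rw [hs]; exact Subgroup.mem_top g
  induction hg using Subgroup.closure_induction with
  | mem t ht => exact hM t ht
  | one =>
      rintro _ ⟨v, rfl⟩
      simp
  | mul g h _ _ ihg ihh =>
      rintro _ ⟨v, rfl⟩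
      have hg' : ∀ w : A.V, A.ρ g w - w ∈ M := fun w => ihg ⟨w, rfl⟩
      have hh' : ∀ w : A.V, A.ρ h w - w ∈ M := fun w => ihh ⟨w, rfl⟩
      have e : A.ρ (g * h) v - v =
          (A.ρ g (A.ρ h v - v) - (A.ρ h v - v)) + (A.ρ h v - v) + (A.ρ g v - v) := by
        simp only [map_mul, Module.End.mul_apply, map_sub]
        abel
      change A.ρ (g * h) v - v ∈ M
      rw [e]
      exact M.add_mem (M.add_mem (hg' _) (hh' _)) (hg' _)
  | inv g _ ih => exact (localTubeSpan_subOneRange_inv_le A g).trans ih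

/-- **Values of undetected cocycles.** If `G` is generated by a set `s` and `M` contains
`(t - 1)A` for all `t ∈ s` (e.g. `G = ⟨T_δ⟩` generated by transvections and `M = span{δ}` the
local vanishing lattice), then every `1`-cocycle whose values on the generators lie in `M` — in
particular every undetected cocycle, `φ t ∈ (t - 1)A` — takes ALL its values in `M`.
[cite: Schnell2010, §7 (proof of Prop. 12)] -/
theorem localTubeSpan_cocycles₁_apply_mem_of_closure_eq_top (s : Set G) (hs : Subgroup.closure s = ⊤)
    (M : Submodule k A.V) (hM : ∀ t ∈ s, subOneRange A t ≤ M) (φ : cocycles₁ A)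
    (hφ : ∀ t ∈ s, (φ : G → A.V) t ∈ M) (g : G) : (φ : G → A.V) g ∈ M := by
  have hstab : ∀ (g : G) (v : A.V), v ∈ M → A.ρ g v ∈ M := fun g v hv => by
    have h1 : A.ρ g v - v ∈ M :=
      localTubeSpan_subOneRange_le_of_closure_eq_top A s hs M hM g ⟨v, rfl⟩
    have : A.ρ g v = (A.ρ g v - v) + v := by abel
    rw [this]
    exact M.add_mem h1 hv
  have hg : g ∈ Subgroup.closure s := by rw [hs]; exact Subgroup.mem_top g
  induction hg using Subgroup.closure_induction with
  | mem t ht => exact hφ t ht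
  | one => simp
  | mul g h _ _ ihg ihh =>
      rw [(mem_cocycles₁_iff φ).1 φ.2 g h]
      exact M.add_mem (hstab g _ ihh) ihg
  | inv g _ ih =>
      have h1 : (φ : G → A.V) g⁻¹ = -(A.ρ g⁻¹ ((φ : G → A.V) g)) := by
        have := congrArg (A.ρ g⁻¹) (cocycles₁_map_inv φ g)
        rwa [Representation.inv_self_apply, map_neg] at this
      rw [h1]
      exact M.neg_mem (hstab _ _ ih)

/-- The card's form: for `G` generated by `s` with `(t - 1)A ⊆ k·δ_t` (`t ∈ s`; transvections
`T_δ`), an undetected cocycle takes its values in the span of the `δ_t` (the local vanishing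
lattice `L = span Δ_loc`). [cite: Schnell2010, §7 (proof of Prop. 12)] -/
theorem localTubeSpan_cocycles₁_apply_mem_span_of_undetected (s : Set G) (hs : Subgroup.closure s = ⊤)
    (δ : s → A.V) (hδ : ∀ t : s, subOneRange A (t : G) ≤ k ∙ δ t) (φ : cocycles₁ A)
    (hφ : ∀ t : s, (φ : G → A.V) t ∈ subOneRange A (t : G)) (g : G) :
    (φ : G → A.V) g ∈ Submodule.span k (Set.range δ) := by
  have hle : ∀ t : s, (k ∙ δ t) ≤ Submodule.span k (Set.range δ) := fun t =>
    Submodule.span_mono (Set.singleton_subset_iff.2 ⟨t, rfl⟩)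
  exact localTubeSpan_cocycles₁_apply_mem_of_closure_eq_top A s hs _
    (fun t ht => (hδ ⟨t, ht⟩).trans (hle ⟨t, ht⟩)) φ
    (fun t ht => ((hδ ⟨t, ht⟩).trans (hle ⟨t, ht⟩)) (hφ ⟨t, ht⟩)) g

end Summit.HodgeConjecture.HodgeConjecture.Theorems

end
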